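/-
Copyright (c) 2026 the pub-hodgecm-mathlib formalisation cell (harness21).  Prover seat hodgecm-mathlib-F0P3a-p02 (g23): dealer LH4-plan (g7) WORD #48, the θ̄ = 1
CORNER of LAYER C (C5)′ in the TRACE frame (SIGFIRST-CornerTrace 06a69e19 head 2, LH3-p02 (g6)); census `F0/P3a/F0P3a-p02/g23/corner1/CENSUS-Corner1.v1.md`; 2026-09-02.
-/
import Literature.NumberTheory.Rogawski1990.UnitOrbitalIntegralInertValueThetaOneTrace       -- ★ (LH5-p03 (g7)): the θ̄ = 1 BRIDGE `natCard_fixedPoints_unitaryInt_traceTorusPi_eq_phiOne_of_bridge` (frozen head 0beebd4f)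
import Literature.NumberTheory.Rogawski1990.UnitOrbitalIntegralInertValueThetaOneCorner      -- ★ the Flicker-frame sibling (A-p03 (g25)): its 2-free cone (`exists_coe_eq_block_of_rel`, `exists_diagRadial`, B-p14, Serre, `diagRadial_mul_diagRadial_inv`)
import Literature.NumberTheory.Rogawski1990.UnitOrbitalIntegralInertValueExponentsTrace     -- ★ p851970 (LH7-p02): `traceCorner_eq` (the type-A form `E = (x₁−x₂) + (x₃−x₁)b`)
import Literature.NumberTheory.Automorphic.UnitaryThreeTorusBlockElementsTrace             -- ★ F1 p851889 (LH3-p02): `traceTorusBlock_mem_centralizer_diag`, `v_eq_one_of_add_map_eq_one`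
import Literature.NumberTheory.Automorphic.UnitaryThreeDoubleCosetsHKTrace                 -- ★ p851802: `exists_coe_eq_flickerU_trace` (the level family `u_m^{(1,−b)}`)
import HarnessLib

/-!
# The `θ̄ = 1` value with the frame data CONSTRUCTED and the scalar `π` NORMALISED, TRACE frame, every residue characteristic:
# `#Fix_{U⧸K}(t_π^{(b)}(x₁,x₂,x₃)) = φ₁(N₁, N)` for ANY `σ`-fixed non-norm `π`, from `UnramifiedLocalConjDatum` data alone
(Flicker (1998), *Elementary proof of the fundamental lemma for a unitary group*, Prop. 11 p. 87 (+ Props. 12–13 through Prop. 10); Prop. 5 p. 82, Prop. 6 p. 83; Kottwitz 1986 §3)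

Topic `NumberTheory/Rogawski1990`; namespace `Literature.NumberTheory.Automorphic.UnitaryGroup` (as the ★ sibling).  THEOREMS ONLY (no definition, no instance, no
notation, no named fact); kernel lane `--supports stmt-HodgeConjecture-24833`.  Cell `pub/hodgecm-mathlib`, crux H413; LH4 board (D-UNR), LAYER C (C5)′ (CENSUS-C5
bd72510a §6 row `…ValueThetaOneCornerTrace`; LH4-plan (g7) WORD #48), the `|2|`-free twin of ★ `UnitOrbitalIntegralInertValueThetaOneCorner` (A-p03 (g25)).

WHAT.  ★ reads Flicker's literal `t_π(a,b,c) = !![e(a+c), 0, −e(a−c)π; 0, b, 0; −e(a−c)π′, 0, e(a+c)]` (`2e = 1`) under a `LocalConjDatum` (`|2| = 1`, corner scalar `yσy = −2`)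
and closes `#Fix_{U⧸K}(t_π) = φ₁(N₁, N)` in four moves over the θ̄ = 1 BRIDGE ★ `natCard_fixedPoints_unitaryInt_flickerTorus_eq_phiOne_of_bridge`.  Here the literal is the
TRACE literal of ★ p851724 ∕ ★ F1 p851889,

  `t_π^{(b)}(x₁,x₂,x₃) = !![x₁σb + x₃b, 0, π(x₁ − x₃); 0, x₂, 0; π′bσb(x₁ − x₃), 0, x₁b + x₃σb]`   (`b + σb = 1`, `|b| ≤ 1`, `|σb − b| = 1`; `ππ′ = 1`, `σπ = π`, `π` not a norm),

the datum is an `UnramifiedLocalConjDatum` (`v ∣ 2` allowed), and the four moves are: §1 (`θ = ϖ`) the frame BUILT from ★ `exists_coe_eq_block_of_rel` (`c = diag(1,−1,1)`),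
★ F1 `traceTorusBlock_mem_centralizer_diag` (`t ∈ Z(c)`), ★ `exists_coe_eq_flickerU_trace` (the level family `u_m^{(1,−b)}` of ★ p851802's currency), ★ `exists_diagRadial`,
the integer frame at `R := 𝒪[K]` with T1's generator `a₀` (`σa₀ − a₀ ∈ 𝒪^×`; NO `IsUnit 2`), the exponent `N₊′ = ord((x₁−x₂)σb + (x₃−x₂)b)` and its dictionary by ★ p851970
(the bridge's type datum `h` — type A `N₁ < N`: `N₂ = N₁`, `|E| = |ϖ^{N₁}|`; type B `N ≤ N₁`: `|E| ≤ |ϖ^N|`, `N₊′ := N` and ★ `phiOne_of_le` — is DERIVED here 2-freely from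
`|b| = |σb| = 1` (★ F1); FINDING #18's `E = 0` family is type B, no separate head); §2 a `σ`-fixed
non-norm has ODD order (★'s lemma is 2-free; re-typed over `UnramifiedLocalConjDatum`); §3 `ord π = 2k+1`: the radial unitary `g = diag(u,1,u⁻¹)`, `u = ϖ^{k+1}`, rescales
`π ↦ πu² =: ϖ″`, a `σ`-fixed uniformiser, `UnramifiedLocalConjDatum σ ϖ″ = ⟨σσ, vσ, σϖ″, vϖ″, trace, norm⟩`, and the count is conjugation invariant (★ B-p14); §4 THE HEAD
`natCard_fixedPoints_unitaryInt_traceTorusPi_eq_phiOne_of_forall_mul_map_ne` = SIGFIRST-CornerTrace 06a69e19 head 2 VERBATIM (consumed by this seat's θ̄ = 1 EXPORT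
`…ValueThetaOneAdicCompletionTrace` and, through it, by ★ p851982's `hX₁` and (C6)-5∕-6).
HONEST LABEL: HC_CM is proved only modulo the 7 printed citations (2 remaining: hLiu418 = stmt-HodgeConjecture-24832, h413 = stmt-HodgeConjecture-24833) until rung 0
closes; count-neutral ((D-UNR) PRINT by D74′); pays no organ, opens no road.

## References
* [Flicker1998UnitaryFL] Y. Z. Flicker, *Elementary proof of the fundamental lemma for a unitary group*, Canad. J. Math. 50 (1998), 74–98: Prop. 3 p. 79, Prop. 5 p. 82,
  Prop. 6 p. 83, §4 p. 85, Prop. 11 p. 87, Props. 12–13 pp. 89–94.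
* [SerreLocalFields1979] J.-P. Serre, *Local Fields*, GTM 67 (1979), Ch. V §2 Prop. 3, Corollary, Remark 1.
* [Rogawski1990] J. D. Rogawski, *Automorphic Representations of Unitary Groups in Three Variables* (1990), §4.9 Prop. 4.9.1 (b) p. 55.
* [Kottwitz1986] R. E. Kottwitz, *Base change for unit elements of Hecke algebras*, Compositio Math. 60 (1986), §3.
-/

set_option autoImplicit false

open scoped MatrixGroups WithZero Valued
open Matrix

namespace Literature.NumberTheory.Automorphic

namespace UnitaryGroup

open Literature.NumberTheory.Automorphic.HermitianLattice (unitaryInt mem_unitaryInt_iff UnramifiedLocalConjDatum)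
open Literature.NumberTheory.Rogawski1990.Flicker1998 (phiOne phiOne_of_le)
open Literature.NumberTheory.Rogawski1990 (diagRadial_mul_diagRadial_inv)
open IsLocalRing

variable {K : Type*} [Field K] [Valued K ℤᵐ⁰] {ϖ : K} (σ : K →+* K) {J : Matrix (Fin 3) (Fin 3) K}

/-! ## §1 `θ = ϖ`: the frame data constructed (trace frame) -/

section ThetaOneCorner

variable [IsDiscreteValuationRing 𝒪[K]] [Finite (ResidueField 𝒪[K])] [IsAdicComplete (maximalIdeal 𝒪[K]) 𝒪[K]]

set_option synthInstance.maxHeartbeats 200000 in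
-- the `H`-action on `H ⧸ (K^{u_m} ∩ H)` (as in ★ (F2))
/-- **`#Fix_{U⧸K}(t_ϖ^{(b)}(x₁,x₂,x₃)) = φ₁(N₁, N)` from the UNRAMIFIED local datum alone** (`θ = ϖ` the uniformiser of the datum; frame elements constructed:
`c = diag(1,−1,1)`, `t ∈ Z(c)` by ★ F1, the level family `u_m^{(1,−b)}` by ★ `exists_coe_eq_flickerU_trace`, the radial family, the integer frame at `R := 𝒪[K]` with the
generator `a₀`; `N = ord(x₁ − x₃)`, `N₁ = ord(x₁ − x₂)`; the bridge's type datum `h` (WORD #52 (V2)) derived from `hN hN₁` and `|b| = |σb| = 1`: type A `N₊′ = N₁`, type B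
`N₊′ := N` with `|E| ≤ |ϖ^N|` and ★ `phiOne_of_le`).  Twin of ★ `natCard_fixedPoints_unitaryInt_corner_eq_phiOne` with `{y} hy {e} h2e` DELETED, `h2`, `{b} (hb) (hbv)`
ADDED, `{a b cc} ↦ {x₁ x₂ x₃}` (T7 `hbδ` lives in the §4 head only: the bridge does not read it). [cite: Flicker1998UnitaryFL, Prop. 11 p. 87; Props. 12–13 pp. 89–94; Prop. 6 p. 83] [cite: Kottwitz1986, §3] -/
theorem natCard_fixedPoints_unitaryInt_traceTorusPi_eq_phiOne (hJ : J = (StdForm.antidiagonal 3).over K) (hd : UnramifiedLocalConjDatum σ ϖ)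
    (h2 : (2 : K) ≠ 0) (hσO : ∀ y : 𝒪[K], (σ.comp 𝒪[K].subtype) y ∈ 𝒪[K])
    {q : ℕ} (hq : Nat.card (ResidueField 𝒪[K]) = q ^ 2)
    {a₀ : 𝒪[K]} (ha₀ : IsUnit (((σ.comp 𝒪[K].subtype).codRestrict 𝒪[K] hσO) a₀ - a₀))
    {b : K} (hb : b + σ b = 1) (hbv : Valued.v b ≤ 1)
    {x₁ x₂ x₃ : K} (hx₁ : σ x₁ * x₁ = 1) (hx₂ : σ x₂ * x₂ = 1) (hx₃ : σ x₃ * x₃ = 1)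
    {t : ↥(unitaryGroupOfForm σ J)}
    (hte : ((t : GL (Fin 3) K) : Matrix (Fin 3) (Fin 3) K) =
      !![x₁ * σ b + x₃ * b, 0, ϖ * (x₁ - x₃); 0, x₂, 0; ϖ⁻¹ * (b * σ b * (x₁ - x₃)), 0, x₁ * b + x₃ * σ b])
    {N N₁ N₂ : ℕ} (hN : Valued.v (x₁ - x₃) = Valued.v (ϖ ^ N)) (hN₁ : Valued.v (x₁ - x₂) = Valued.v (ϖ ^ N₁))
    (hN₂ : Valued.v (x₃ - x₂) = Valued.v (ϖ ^ N₂))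
    (hfin : {x : ↥(unitaryGroupOfForm σ J) ⧸ unitaryInt σ J | t • x = x}.Finite) :
    (Nat.card {x : ↥(unitaryGroupOfForm σ J) ⧸ unitaryInt σ J | t • x = x} : ℚ) = phiOne q N₁ N := by
  classical
  have hϖ0 : ϖ ≠ 0 := hd.ϖ_ne_zero
  -- the literal in the bridge's `θ = ϖ ^ 1` spelling
  have hte' : ((t : GL (Fin 3) K) : Matrix (Fin 3) (Fin 3) K) =
      !![x₁ * σ b + x₃ * b, 0, ϖ ^ 1 * (x₁ - x₃); 0, x₂, 0; (ϖ ^ 1)⁻¹ * (b * σ b * (x₁ - x₃)), 0, x₁ * b + x₃ * σ b] := by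
    rw [hte, pow_one]
  -- `c = diag(1, −1, 1)`
  obtain ⟨c, hc⟩ := exists_coe_eq_block_of_rel σ hJ (α := 1) (β := 0) (γ := 0) (δ := 1) (e := -1)
    (by rw [map_one, map_zero]; ring) (by rw [map_one, map_zero]; ring) (by rw [map_zero, map_one]; ring) (by rw [map_zero, map_one]; ring)
    (by rw [map_neg, map_one]; ring)
  have htH : t ∈ Subgroup.centralizer ({c} : Set ↥(unitaryGroupOfForm σ J)) := traceTorusBlock_mem_centralizer_diag σ hc hte
  -- the level elements `u_m^{(1,−b)}` (★ p851802's currency with `(y, z) := (1, −b)`) and the radial family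
  have hu := fun m => exists_coe_eq_flickerU_trace σ hJ hd hb m
  choose u hum using hu
  have hum' : ∀ m, ((u m : GL (Fin 3) K) : Matrix (Fin 3) (Fin 3) K) = !![ϖ ^ m, 1, -b * (ϖ ^ m)⁻¹; 0, 1, -σ 1 * (ϖ ^ m)⁻¹; 0, 0, (ϖ ^ m)⁻¹] := by
    intro m; rw [hum m]; simp only [map_one, neg_mul, one_mul]
  have hyz : -b + σ (-b) + 1 * σ 1 = 0 := by rw [map_neg, map_one]; linear_combination -hb
  have hyl : Valued.v (1 : K) = 1 := map_one _
  have hzl : Valued.v (-b) ≤ 1 := by rw [Valuation.map_neg]; exact hbv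
  obtain ⟨r, hr⟩ := exists_diagRadial σ hJ hd.σϖ hϖ0 hc
  -- the integer frame at `R := 𝒪[K]`; the generator `a₀` serves as T1's `gR`
  set σO : 𝒪[K] →+* 𝒪[K] := (σ.comp 𝒪[K].subtype).codRestrict 𝒪[K] hσO with hσOdef
  have hσOσO : ∀ z, σO (σO z) = z := fun z => Subtype.ext (hd.σσ (z : K))
  have hιv : ∀ x : K, Valued.v x ≤ 1 ↔ x ∈ Set.range (𝒪[K].subtype) :=
    fun x => ⟨fun hx => ⟨⟨x, hx⟩, rfl⟩, by rintro ⟨z, rfl⟩; exact z.2⟩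
  have hσι : ∀ z : 𝒪[K], 𝒪[K].subtype (σO z) = σ (𝒪[K].subtype z) := fun z => rfl
  have hϖle : Valued.v ϖ ≤ 1 := by rw [hd.vϖ, ← WithZero.exp_zero]; exact WithZero.exp_le_exp.2 (by norm_num)
  have hp : Irreducible (⟨ϖ, hϖle⟩ : 𝒪[K]) := (IsDiscreteValuationRing.irreducible_iff_uniformizer _).2 (maximalIdeal_integer_eq_span hd.vϖ)
  -- `1 < q`: the residue field is a finite field
  have hq1 : 1 < q := by
    have h1 : 1 < Nat.card (ResidueField 𝒪[K]) := Finite.one_lt_card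
    rw [hq] at h1
    exact (Nat.one_lt_pow_iff two_ne_zero).1 h1
  -- the TYPE DATUM `h` of the bridge (★ `…Trichotomy`'s shape on the trace corner `E = (x₁−x₂)σb + (x₃−x₂)b`; 2-free: `|b| = |σb| = 1` by ★ F1)
  obtain ⟨hb1, hσb1, -⟩ := v_eq_one_of_add_map_eq_one σ hd.vσ hbv hb
  have vle : ∀ {i j : ℕ}, Valued.v (ϖ ^ i) ≤ Valued.v (ϖ ^ j) ↔ j ≤ i := fun {i j} => by rw [hd.v_pow, hd.v_pow, WithZero.exp_le_exp]; omega
  have vlt : ∀ {i j : ℕ}, Valued.v (ϖ ^ i) < Valued.v (ϖ ^ j) ↔ j < i := fun {i j} => by rw [hd.v_pow, hd.v_pow, WithZero.exp_lt_exp]; omega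
  have hv31 : Valued.v (x₃ - x₁) = Valued.v (ϖ ^ N) := by rw [← Valuation.map_sub_swap, hN]
  have hv32 : Valued.v (x₃ - x₂) ≤ max (Valued.v (ϖ ^ N)) (Valued.v (ϖ ^ N₁)) := by
    have e1 : x₃ - x₂ = (x₃ - x₁) + (x₁ - x₂) := by ring
    rw [e1, ← hv31, ← hN₁]; exact Valuation.map_add _ _ _
  rcases lt_or_ge N₁ N with hlt | hle
  · -- type A: `N₁ < N` ⇒ `N₂ = N₁` and `|E| = |ϖ^{N₁}|` (read from `E = (x₁ − x₂) + (x₃ − x₁)·b`)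
    have es : (x₁ - x₂) * σ b + (x₃ - x₂) * b = (x₁ - x₂) + (x₃ - x₁) * b := traceCorner_eq σ hb x₁ x₂ x₃
    have hsmall : Valued.v ((x₃ - x₁) * b) < Valued.v (x₁ - x₂) := by rw [map_mul, hb1, mul_one, hv31, hN₁, vlt]; exact hlt
    have hvE : Valued.v ((x₁ - x₂) * σ b + (x₃ - x₂) * b) = Valued.v (ϖ ^ N₁) := by
      rw [es, Valuation.map_add_eq_of_lt_left _ hsmall, hN₁]
    have hN₂' : N₂ = N₁ := by
      have e1 : x₃ - x₂ = (x₁ - x₂) + (x₃ - x₁) := by ring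
      have hsmall' : Valued.v (x₃ - x₁) < Valued.v (x₁ - x₂) := by rw [hv31, hN₁, vlt]; exact hlt
      have h32 : Valued.v (x₃ - x₂) = Valued.v (ϖ ^ N₁) := by rw [e1, Valuation.map_add_eq_of_lt_left _ hsmall', hN₁]
      rw [hN₂, hd.v_pow, hd.v_pow, WithZero.exp_inj] at h32
      omega
    exact natCard_fixedPoints_unitaryInt_traceTorusPi_eq_phiOne_of_bridge σ hJ hd h2 hσO hc u hyl hzl hyz hum'
      𝒪[K].subtype Subtype.val_injective hιv σO hσOσO hσι ha₀ hp rfl hb hbv rfl rfl hx₁ hx₂ hx₃ hte' htH r hr hN (Or.inl ⟨hlt, hN₂', rfl, hvE⟩)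
      hq hq hq1 ha₀ hfin
  · -- type B: `N ≤ N₁` ⇒ `|E| ≤ |ϖ^N|`; the bridge at `N₊′ := N` gives `φ₁(N, N) = φ₁(N₁, N)` (both the `N ≤ ·` branch, ★ `phiOne_of_le`)
    have hvE : Valued.v ((x₁ - x₂) * σ b + (x₃ - x₂) * b) ≤ Valued.v (ϖ ^ N) := by
      refine le_trans (Valuation.map_add _ _ _) (max_le ?_ ?_)
      · rw [map_mul, hσb1, mul_one, hN₁, vle]; exact hle
      · rw [map_mul, hb1, mul_one]
        refine le_trans hv32 (max_le le_rfl ?_)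
        rw [vle]; exact hle
    rw [phiOne_of_le q hle, ← phiOne_of_le q (le_refl N)]
    exact natCard_fixedPoints_unitaryInt_traceTorusPi_eq_phiOne_of_bridge (N₂ := N₂) σ hJ hd h2 hσO hc u hyl hzl hyz hum'
      𝒪[K].subtype Subtype.val_injective hιv σO hσOσO hσι ha₀ hp rfl hb hbv rfl rfl hx₁ hx₂ hx₃ hte' htH r hr hN (Or.inr ⟨hle, le_rfl, hvE⟩)
      hq hq hq1 ha₀ hfin

/-! ## §2 A `σ`-fixed non-norm has odd order (unramified datum) -/

/-- **A `σ`-fixed element which is not a norm `σ(z)·z` has ODD valuation** — ★ `exists_valued_eq_exp_two_mul_add_one_of_forall_mul_map_ne` re-typed over an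
`UnramifiedLocalConjDatum` (the ★ proof reads `σσ`, `σϖ`, `vϖ` only: were `ord π = 2j`, `πϖ^{−2j}` would be a `σ`-fixed UNIT, hence a norm by Serre's «`U_F = N U_E`», ★
`exists_mul_map_eq_of_finite_residueField`, whose hypothesis «`σ` moves an integer by a unit» is `ha₀`). [cite: SerreLocalFields1979, Ch. V §2 Prop. 3, Corollary and Remark 1]
[cite: Flicker1998UnitaryFL, Prop. 3 p. 79] -/
theorem exists_valued_eq_exp_two_mul_add_one_of_forall_mul_map_ne_unram (hd : UnramifiedLocalConjDatum σ ϖ)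
    (hσO : ∀ y : 𝒪[K], (σ.comp 𝒪[K].subtype) y ∈ 𝒪[K])
    {a₀ : 𝒪[K]} (ha₀ : IsUnit (((σ.comp 𝒪[K].subtype).codRestrict 𝒪[K] hσO) a₀ - a₀))
    {π : K} (hσπ : σ π = π) (hπN : ∀ z : K, σ z * z ≠ π) :
    ∃ k : ℤ, Valued.v π = WithZero.exp (2 * k + 1) := by
  have hϖ0 : ϖ ≠ 0 := hd.ϖ_ne_zero
  have hπ0 : π ≠ 0 := fun h => hπN 0 (by rw [map_zero, mul_zero, h])
  obtain ⟨m, hm⟩ : ∃ m : ℤ, Valued.v π = WithZero.exp m := ⟨_, (WithZero.exp_log ((Valuation.ne_zero_iff _).2 hπ0)).symm⟩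
  rcases Int.even_or_odd' m with ⟨j, hj | hj⟩
  · -- even order `m = 2j`: `w := π ϖ^{j}·ϖ^{j}` is a `σ`-fixed unit, hence a norm — contradiction
    exfalso
    have hvϖj : Valued.v (ϖ ^ j) = WithZero.exp (-j) := by
      rw [map_zpow₀, hd.vϖ, ← WithZero.exp_zsmul]; congr 1; ring
    have hσϖj : σ (ϖ ^ j) = ϖ ^ j := by rw [map_zpow₀, hd.σϖ]
    set w : K := π * (ϖ ^ j * ϖ ^ j) with hwdef
    have hvw : Valued.v w = 1 := by
      rw [hwdef, map_mul, map_mul, hm, hvϖj, ← WithZero.exp_add, ← WithZero.exp_add, hj, ← WithZero.exp_zero]; congr 1; ring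
    have hσw : σ w = w := by rw [hwdef, map_mul, map_mul, hσπ, hσϖj]
    set σO : 𝒪[K] →+* 𝒪[K] := (σ.comp 𝒪[K].subtype).codRestrict 𝒪[K] hσO with hσOdef
    have hσOσO : ∀ z, σO (σO z) = z := fun z => Subtype.ext (hd.σσ (z : K))
    let wO : 𝒪[K] := ⟨w, hvw.le⟩
    have hwOu : IsUnit wO := (Valuation.Integers.isUnit_iff_valuation_eq_one (Valuation.integer.integers _)).2 hvw
    have hσwO : σO wO = wO := Subtype.ext hσw
    obtain ⟨s, hs⟩ := Literature.NumberTheory.LocalFields.UnramifiedQuadraticNorm.exists_mul_map_eq_of_finite_residueField σO hσOσO ha₀ wO hwOu hσwO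
    have hs' : (s : K) * σ (s : K) = w := by
      have := congrArg Subtype.val hs; simpa [hσOdef] using this
    -- `π = (s ϖ^{−j}) · σ(s ϖ^{−j})`
    have hϖj0 : ϖ ^ j ≠ 0 := zpow_ne_zero _ hϖ0
    refine hπN ((s : K) * (ϖ ^ j)⁻¹) ?_
    rw [map_mul, map_inv₀, hσϖj]
    have : π = w * ((ϖ ^ j)⁻¹ * (ϖ ^ j)⁻¹) := by
      rw [hwdef]; field_simp
    rw [this, ← hs']; ring
  · exact ⟨j, by rw [hm, hj]⟩

/-! ## §3 `ord π` odd: the radial normalisation `π ↦ π u²`, `u = ϖ^{k+1}` (trace block) -/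

omit [Valued K ℤᵐ⁰] [IsDiscreteValuationRing 𝒪[K]] [Finite (ResidueField 𝒪[K])] [IsAdicComplete (maximalIdeal 𝒪[K]) 𝒪[K]] in
/-- **Radial conjugation of a torus block** (ring identity): `diag(u,1,u′)·!![A,0,B; 0,m,0; C,0,D] = !![A,0,B·u·u; 0,m,0; C·u′·u′,0,D]·diag(u,1,u′)` for `uu′ = 1` — the
trace-frame twin of ★ `diagRadial_mul_flickerTorusElt` (Flicker's `r` of Prop. 6). [cite: Flicker1998UnitaryFL, Prop. 6 p. 83] -/
theorem diagRadial_mul_block {u u' A B C D m : K} (hu : u * u' = 1) :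
    !![u, 0, 0; 0, 1, 0; 0, 0, u'] * !![A, 0, B; 0, m, 0; C, 0, D] = !![A, 0, B * u * u; 0, m, 0; C * u' * u', 0, D] * !![u, 0, 0; 0, 1, 0; 0, 0, u'] := by
  have hu' : u' * u = 1 := by rw [mul_comm]; exact hu
  ext i j
  fin_cases i <;> fin_cases j <;> simp [Matrix.mul_apply, Fin.sum_univ_three] <;> grind

set_option synthInstance.maxHeartbeats 200000 in
-- the `H`-action on `H ⧸ (K^{u_m} ∩ H)` (as in ★ (F2))
/-- **`#Fix_{U⧸K}(t_π^{(b)}(x₁,x₂,x₃)) = φ₁(N₁, N)` for `π` `σ`-fixed of ODD order `|π| = exp(2k+1)`** (`ππ′ = 1`): conjugation by the radial unitary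
`g = diag(u, 1, u⁻¹)`, `u = ϖ^{k+1}`, carries `t_π^{(b)}` to `t_{ϖ″}^{(b)}` with `ϖ″ = πu²` a `σ`-fixed UNIFORMISER, to which §1 applies with the datum
`UnramifiedLocalConjDatum σ ϖ″` (same `σ`-data, `trace`, `norm`); the count and its finiteness are conjugation invariant (★ B-p14).  Twin of ★
`natCard_fixedPoints_unitaryInt_corner_eq_phiOne_of_valued_eq`. [cite: Flicker1998UnitaryFL, Prop. 5 p. 82; Prop. 6 p. 83; Prop. 11 p. 87] -/
theorem natCard_fixedPoints_unitaryInt_traceTorusPi_eq_phiOne_of_valued_eq (hJ : J = (StdForm.antidiagonal 3).over K) (hd : UnramifiedLocalConjDatum σ ϖ)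
    (h2 : (2 : K) ≠ 0) (hσO : ∀ y : 𝒪[K], (σ.comp 𝒪[K].subtype) y ∈ 𝒪[K])
    {q : ℕ} (hq : Nat.card (ResidueField 𝒪[K]) = q ^ 2)
    {a₀ : 𝒪[K]} (ha₀ : IsUnit (((σ.comp 𝒪[K].subtype).codRestrict 𝒪[K] hσO) a₀ - a₀))
    {b : K} (hb : b + σ b = 1) (hbv : Valued.v b ≤ 1)
    {x₁ x₂ x₃ π π' : K} (hx₁ : σ x₁ * x₁ = 1) (hx₂ : σ x₂ * x₂ = 1) (hx₃ : σ x₃ * x₃ = 1)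
    (hσπ : σ π = π) (hππ' : π * π' = 1) {k : ℤ} (hπ : Valued.v π = WithZero.exp (2 * k + 1))
    {t : ↥(unitaryGroupOfForm σ J)}
    (hte : ((t : GL (Fin 3) K) : Matrix (Fin 3) (Fin 3) K) =
      !![x₁ * σ b + x₃ * b, 0, π * (x₁ - x₃); 0, x₂, 0; π' * (b * σ b * (x₁ - x₃)), 0, x₁ * b + x₃ * σ b])
    {N N₁ N₂ : ℕ} (hN : Valued.v (x₁ - x₃) = WithZero.exp (-(N : ℤ))) (hN₁ : Valued.v (x₁ - x₂) = WithZero.exp (-(N₁ : ℤ)))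
    (hN₂ : Valued.v (x₃ - x₂) = WithZero.exp (-(N₂ : ℤ)))
    (hfin : {x : ↥(unitaryGroupOfForm σ J) ⧸ unitaryInt σ J | t • x = x}.Finite) :
    (Nat.card {x : ↥(unitaryGroupOfForm σ J) ⧸ unitaryInt σ J | t • x = x} : ℚ) = phiOne q N₁ N := by
  classical
  have hϖ0 : ϖ ≠ 0 := hd.ϖ_ne_zero
  have hπ0 : π ≠ 0 := fun h => by rw [h, zero_mul] at hππ'; exact zero_ne_one hππ'
  have hπ' : π' = π⁻¹ := eq_inv_of_mul_eq_one_right hππ'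
  -- the radial scalar `u = ϖ^{k+1}`
  set uu : K := ϖ ^ (k + 1) with huudef
  have huu0 : uu ≠ 0 := zpow_ne_zero _ hϖ0
  have hσuu : σ uu = uu := by rw [huudef, map_zpow₀, hd.σϖ]
  have hvuu : Valued.v uu = WithZero.exp (-(k + 1)) := by
    rw [huudef, map_zpow₀, hd.vϖ, ← WithZero.exp_zsmul]; congr 1; ring
  -- the normalised uniformiser `ϖ″ = π u²`
  set ϖ'' : K := π * uu * uu with hϖ''def
  have hσϖ'' : σ ϖ'' = ϖ'' := by rw [hϖ''def, map_mul, map_mul, hσπ, hσuu]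
  have hvϖ'' : Valued.v ϖ'' = WithZero.exp (-1 : ℤ) := by
    rw [hϖ''def, map_mul, map_mul, hπ, hvuu, ← WithZero.exp_add, ← WithZero.exp_add]; congr 1; ring
  have hd'' : UnramifiedLocalConjDatum σ ϖ'' := ⟨hd.σσ, hd.vσ, hσϖ'', hvϖ'', hd.trace, hd.norm⟩
  have hϖ''0 : ϖ'' ≠ 0 := hd''.ϖ_ne_zero
  -- the radial unitary `g = diag(u, 1, u⁻¹)`
  obtain ⟨g, hg⟩ := exists_coe_eq_block_of_rel σ hJ (α := uu) (β := 0) (γ := 0) (δ := uu⁻¹) (e := 1)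
    (by rw [map_zero]; ring) (by rw [hσuu, map_zero, mul_inv_cancel₀ huu0]; ring) (by rw [map_zero, map_inv₀, hσuu, inv_mul_cancel₀ huu0]; ring)
    (by rw [map_zero, map_inv₀, hσuu]; ring) (by rw [map_one, mul_one])
  -- `g t g⁻¹ = t_{ϖ″}^{(b)}`
  have hconj : (((g * t * g⁻¹ : ↥(unitaryGroupOfForm σ J)) : GL (Fin 3) K) : Matrix (Fin 3) (Fin 3) K) =
      !![x₁ * σ b + x₃ * b, 0, ϖ'' * (x₁ - x₃); 0, x₂, 0; ϖ''⁻¹ * (b * σ b * (x₁ - x₃)), 0, x₁ * b + x₃ * σ b] := by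
    have hmul := diagRadial_mul_block (A := x₁ * σ b + x₃ * b) (B := π * (x₁ - x₃)) (C := π' * (b * σ b * (x₁ - x₃))) (D := x₁ * b + x₃ * σ b) (m := x₂)
      (mul_inv_cancel₀ huu0)
    have h13 : π * (x₁ - x₃) * uu * uu = ϖ'' * (x₁ - x₃) := by rw [hϖ''def]; ring
    have h31 : π' * (b * σ b * (x₁ - x₃)) * uu⁻¹ * uu⁻¹ = ϖ''⁻¹ * (b * σ b * (x₁ - x₃)) := by
      rw [hϖ''def, hπ', mul_inv, mul_inv]; ring
    rw [h13, h31] at hmul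
    have hginv : (((g⁻¹ : ↥(unitaryGroupOfForm σ J)) : GL (Fin 3) K) : Matrix (Fin 3) (Fin 3) K) = !![uu⁻¹, 0, 0; 0, 1, 0; 0, 0, uu] := by
      rw [Subgroup.coe_inv, Matrix.coe_units_inv, hg]
      exact Matrix.inv_eq_left_inv (diagRadial_mul_diagRadial_inv (inv_mul_cancel₀ huu0))
    rw [Subgroup.coe_mul, Subgroup.coe_mul, Units.val_mul, Units.val_mul, hg, hte, hmul, hginv, Matrix.mul_assoc,
      diagRadial_mul_diagRadial_inv (mul_inv_cancel₀ huu0), Matrix.mul_one]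
  -- conjugation invariance of the count and of its finiteness (`g t g⁻¹ = (g⁻¹)⁻¹ t g⁻¹`)
  have hgtg : (g⁻¹)⁻¹ * t * g⁻¹ = g * t * g⁻¹ := by rw [inv_inv]
  have hcard := natCard_fixedPoints_quotient_conj_eq σ (unitaryInt σ J) g⁻¹ t
  have hfin' : {x : ↥(unitaryGroupOfForm σ J) ⧸ unitaryInt σ J | (g * t * g⁻¹) • x = x}.Finite := by
    rw [← hgtg]; exact (finite_fixedPoints_quotient_conj_iff σ (unitaryInt σ J) g⁻¹ t).2 hfin
  rw [hgtg] at hcard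
  rw [← hcard]
  -- §1 at the datum `ϖ″`
  exact natCard_fixedPoints_unitaryInt_traceTorusPi_eq_phiOne σ hJ hd'' h2 hσO hq ha₀ hb hbv hx₁ hx₂ hx₃ hconj
    (by rw [hN, hd''.v_pow]) (by rw [hN₁, hd''.v_pow]) (by rw [hN₂, hd''.v_pow]) hfin'

/-! ## §4 The head (SIGFIRST-CornerTrace 06a69e19 head 2): the scalar hypotheses verbatim -/

set_option synthInstance.maxHeartbeats 200000 in
-- the `H`-action on `H ⧸ (K^{u_m} ∩ H)` (as in ★ (F2))
/-- **LAYER C (C5)′, `θ̄ = 1`, TRACE frame, frame and scalar discharged: `#Fix_{U⧸K}(t_π^{(b)}(x₁,x₂,x₃)) = φ₁(N₁, N)`** for any `σ`-fixed scalar `π` with `ππ′ = 1` which is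
NOT a norm `σ(z)·z` (§2: `ord π` odd; §3), the trace element `b` (`b + σb = 1`, `|b| ≤ 1`, `|σb − b| = 1`), norm-one `x₁, x₂, x₃` with `|x₁ − x₃| = q^{−N}`,
`|x₁ − x₂| = q^{−N₁}`, `|x₃ − x₂| = q^{−N₂}`, under an UNRAMIFIED local conjugation datum — every residue characteristic.  Twin of ★
`natCard_fixedPoints_unitaryInt_corner_eq_phiOne_of_forall_mul_map_ne`; the head the θ̄ = 1 EXPORT `natCard_fixedPoints_unitaryInt_traceTorusPi_eq_phiOne_adicCompletion`
instantiates at `K = L_w`. [cite: Flicker1998UnitaryFL, Prop. 3 p. 79; Prop. 5 p. 82; Prop. 11 p. 87; Props. 12–13 pp. 89–94] [cite: Kottwitz1986, §3] -/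
theorem natCard_fixedPoints_unitaryInt_traceTorusPi_eq_phiOne_of_forall_mul_map_ne (hJ : J = (StdForm.antidiagonal 3).over K)
    (hd : UnramifiedLocalConjDatum σ ϖ) (h2 : (2 : K) ≠ 0)
    (hσO : ∀ y : 𝒪[K], (σ.comp 𝒪[K].subtype) y ∈ 𝒪[K])
    {q : ℕ} (hq : Nat.card (ResidueField 𝒪[K]) = q ^ 2)
    {a₀ : 𝒪[K]} (ha₀ : IsUnit (((σ.comp 𝒪[K].subtype).codRestrict 𝒪[K] hσO) a₀ - a₀))
    {b : K} (hb : b + σ b = 1) (hbv : Valued.v b ≤ 1) (hbδ : Valued.v (σ b - b) = 1)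
    {x₁ x₂ x₃ π π' : K} (hx₁ : σ x₁ * x₁ = 1) (hx₂ : σ x₂ * x₂ = 1) (hx₃ : σ x₃ * x₃ = 1)
    (hσπ : σ π = π) (hππ' : π * π' = 1) (hπN : ∀ z : K, σ z * z ≠ π)
    {t : ↥(unitaryGroupOfForm σ J)}
    (hte : ((t : GL (Fin 3) K) : Matrix (Fin 3) (Fin 3) K) =
      !![x₁ * σ b + x₃ * b, 0, π * (x₁ - x₃); 0, x₂, 0; π' * (b * σ b * (x₁ - x₃)), 0, x₁ * b + x₃ * σ b])
    {N N₁ N₂ : ℕ} (hN : Valued.v (x₁ - x₃) = WithZero.exp (-(N : ℤ))) (hN₁ : Valued.v (x₁ - x₂) = WithZero.exp (-(N₁ : ℤ)))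
    (hN₂ : Valued.v (x₃ - x₂) = WithZero.exp (-(N₂ : ℤ)))
    (hfin : {x : ↥(unitaryGroupOfForm σ J) ⧸ unitaryInt σ J | t • x = x}.Finite) :
    (Nat.card {x : ↥(unitaryGroupOfForm σ J) ⧸ unitaryInt σ J | t • x = x} : ℚ) = phiOne q N₁ N := by
  -- T7 `hbδ` is CARRIED UNREAD by ruling (LH4-plan (g7) WORD #15 (D3): both Corner heads and both EXPORTS carry it for (C3)′'s R2); the bridge does not take it
  have _hbδ : Valued.v (σ b - b) = 1 := hbδ
  obtain ⟨k, hk⟩ := exists_valued_eq_exp_two_mul_add_one_of_forall_mul_map_ne_unram σ hd hσO ha₀ hσπ hπN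
  exact natCard_fixedPoints_unitaryInt_traceTorusPi_eq_phiOne_of_valued_eq σ hJ hd h2 hσO hq ha₀ hb hbv hx₁ hx₂ hx₃ hσπ hππ' hk hte hN hN₁ hN₂ hfin

end ThetaOneCorner

end UnitaryGroup

end Literature.NumberTheory.Automorphic
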